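import Summits.QuantumAdvantage.QuantumAdvantage.Theorems.LinnikCubicClassGroupsDegreeOnePrimesEscapeRayClassSmoothed
import Literature.NumberTheory.LFunctions.WindowWeight
import Literature.NumberTheory.LFunctions.ClassGroupExplicitFormula
import HarnessLib

/-!
# Short intervals for cosets of a congruence class group, I: the smoothed coset sums against a WINDOW weight through
# the explicit formulae of the whole family, two-sided, with the exceptional zeros kept

Topic `Summits/QuantumAdvantage/QuantumAdvantage/Theorems`, cell B2b-1 (linnik-cubic), PART A (gen 23); helper toward
the crux `DegreeOnePrimesEscape` (stmt-QuantumAdvantage-11543) of route `LinnikCubicClassGroups` — first file of the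
HOHEISEL–LINNIK THEOREM FOR COSETS OF A CONGRUENCE CLASS GROUP (primes of every narrow ray class in short intervals of
the Linnik range); the window-weight counterpart of `…RayClassSmoothed` (gen 22, Thorner–Zaman weight) and the
ray-class counterpart of `…ShortIntervalSmoothed` (gen 5, ideal classes).  HONEST FRAMING: the value of this file is a
THEOREM (kernel-checked, GRH-free) — NOT summit progress.

For a number field `K`, an abelian Frobenius datum `f : 𝔭 ↦ f 𝔭 ∈ G` killing the narrow ray `mod 𝔪 ≠ 0` whose
non-trivial characters are non-principal off `𝔪`, a coset `τ ∈ G`, the window weight `g = windowTest lo hi ε`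
(`0 < ε < lo < hi`, `ε ≤ 1`), its Laplace transform `F` and the family `F_ψ = rayFamF … ψ`:
* `norm_coefFordK_sub_le_of_windowTest` — imprimitive versus primitive smoothed prime-power sums against the window
  weight: `‖K_{g,a}(0) − K_{g,b}(0)‖ ≤ 2(hi + 2) log N𝔪` whenever `‖a(n) − b(n)‖ ≤ Σ_{N𝔫 = n, (𝔫,𝔪) ≠ 1} Λ(𝔫)`
  (Thorner–Zaman 2017 Lemma 9.3 bookkeeping, `RayClassImprimitiveCoefficients`);
* `norm_coefFordK_rayFamF_window_sub_le` — the explicit formula of `F_ψ` read two-sidedly through the imprimitive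
  coefficients `Λ^𝔪_ψ`, exceptional zeros kept:
  `‖K_{g,Λ^𝔪_ψ}(0) − [ψ = 0]F(−1) + Σ_{ρ ∈ Exc} m_ψ(ρ)F(−ρ)‖ ≤ B + M₀ + J + 2(hi + 2) log N𝔪`;
* `norm_card_mul_smoothedPsiFiber_window_sub_le` — the assembly by orthogonality (`card_mul_smoothedPsiFiber`):
  `‖|G| ψ̃_τ(g) − F(−1) + Σ_ψ ψ(τ)⁻¹ Σ_{ρ ∈ Exc ψ} m_ψ(ρ)F(−ρ)‖ ≤ Bf + |G|(M₀ + J + 2(hi + 2) log N𝔪)`.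
References: J. Thorner, A. Zaman, ANT 11 (2017), §§8–9 [ThornerZaman2017]; ANT 13 (2019), §5 [ThornerZaman2019];
G. Hoheisel (1930); [LagariasMontgomeryOdlyzko1979, §7].
-/

noncomputable section

open Complex Real Set Filter Topology NumberField IsDedekindDomain
open scoped NumberField nonZeroDivisors

namespace Summit.QuantumAdvantage.QuantumAdvantage.Theorems.DegreeOnePrimesEscape

open Literature.NumberTheory.LFunctions Literature.NumberTheory.LFunctions.NumberField
  Literature.NumberTheory.LFunctions.EntireEF Literature.NumberTheory.LFunctions.WindowWeight
  Literature.NumberTheory.LFunctions.AbelianDensity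
open scoped Classical

variable {K : Type} [Field K] [NumberField K]

/-! ### Imprimitive versus primitive coefficients against the window weight -/

/-- Generic comparison of two smoothed coefficient sums: if `‖a(n) − b(n)‖ ≤ d(n)`, `|g| ≤ 1` and `g = 0` on
`[X, ∞)` with `X ≤ log N` (`N ≥ 1`), then `‖K_{g,a}(0) − K_{g,b}(0)‖ ≤ Σ_{n<N} d(n)`. -/
private theorem norm_coefFordK_sub_coefFordK_le' {a b : ℕ → ℂ} {d : ℕ → ℝ} (hab : ∀ n, ‖a n - b n‖ ≤ d n)
    {g : ℝ → ℝ} (hg1 : ∀ u, |g u| ≤ 1) {X : ℝ} (hg0 : ∀ u, X ≤ u → g u = 0) {N : ℕ} (hN : 1 ≤ N)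
    (hX : X ≤ Real.log N) :
    ‖coefFordK a g 0 - coefFordK b g 0‖ ≤ ∑ n ∈ Finset.range N, d n := by
  rw [coefFordK_eq_sum a hg0 hN hX, coefFordK_eq_sum b hg0 hN hX, ← Finset.sum_sub_distrib]
  refine (norm_sum_le _ _).trans (Finset.sum_le_sum fun n _ ↦ ?_)
  rw [← sub_mul, ← sub_mul, neg_zero, Complex.cpow_zero, mul_one, norm_mul, Complex.norm_real,
    Real.norm_eq_abs]
  have hd : 0 ≤ d n := le_trans (norm_nonneg _) (hab n)
  calc ‖a n - b n‖ * |g (Real.log n)| ≤ d n * 1 := mul_le_mul (hab n) (hg1 _) (abs_nonneg _) hd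
    _ = d n := mul_one _

/-- **The smoothed sums against the window weight**: if `‖a(n) − b(n)‖ ≤ Σ_{N𝔫 = n, (𝔫,𝔪)≠1} Λ(𝔫)` for all `n`, then
for `g = windowTest lo hi ε` (`0 < ε ≤ 1`, `0 ≤ hi`): `‖K_{g,a}(0) − K_{g,b}(0)‖ ≤ 2(hi + 2) log N𝔪`.
[cite: ThornerZaman2017, Lemma 9.3] -/
theorem norm_coefFordK_sub_le_of_windowTest {𝔪 : Ideal (𝓞 K)} (h𝔪 : 𝔪 ≠ ⊥) {a b : ℕ → ℂ}
    (hab : ∀ n, ‖a n - b n‖ ≤ ∑ I ∈ (idealsOfNorm K n).filter (fun I ↦ ¬ IsCoprime I 𝔪), idealVonMangoldt I)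
    {lo hi ε : ℝ} (hhi : 0 ≤ hi) (hε : 0 < ε) (hε1 : ε ≤ 1) :
    ‖coefFordK a (windowTest lo hi ε) 0 - coefFordK b (windowTest lo hi ε) 0‖ ≤
      2 * (hi + 2) * Real.log (Ideal.absNorm 𝔪 : ℕ) := by
  set N : ℕ := ⌊Real.exp (hi + ε)⌋₊ + 1 with hN
  have hN1 : 1 ≤ N := by rw [hN]; omega
  have hE0 : 0 < Real.exp (hi + ε) := Real.exp_pos _
  have hNlt : Real.exp (hi + ε) < N := by rw [hN]; push_cast; exact Nat.lt_floor_add_one _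
  have hN0 : (0 : ℝ) < N := hE0.trans hNlt
  have hXN : hi + ε ≤ Real.log N := by
    have := Real.log_lt_log hE0 hNlt
    rw [Real.log_exp] at this; exact this.le
  have hNle : (N : ℝ) ≤ 2 * Real.exp (hi + ε) := by
    rw [hN]; push_cast
    have h1 := Nat.floor_le hE0.le
    have h2 : (1 : ℝ) ≤ Real.exp (hi + ε) := Real.one_le_exp (by linarith)
    linarith
  have hlogN : Real.log N ≤ hi + 2 := by
    have h1 := Real.log_le_log hN0 hNle
    rw [Real.log_mul (by norm_num) hE0.ne', Real.log_exp] at h1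
    have hl2 : Real.log 2 < 1 := by have := Real.log_two_lt_d9; linarith
    linarith
  have hg1 : ∀ u, |windowTest lo hi ε u| ≤ 1 := fun u ↦ by
    rw [abs_of_nonneg (windowTest_nonneg lo hi ε u)]; exact windowTest_le_one lo hi ε u
  have hkey := norm_coefFordK_sub_coefFordK_le' hab hg1 (fun u hu ↦ windowTest_eq_zero_of_ge hε hu) hN1 hXN
  refine hkey.trans ((sum_range_idealVonMangoldt_not_isCoprime_le h𝔪 N).trans ?_)
  have hlogm : 0 ≤ Real.log (Ideal.absNorm 𝔪 : ℕ) := Real.log_natCast_nonneg _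
  have hl2 : (1 : ℝ) / 2 < Real.log 2 := by have := Real.log_two_gt_d9; linarith
  have hdiv : Real.log N / Real.log 2 ≤ 2 * (hi + 2) := by
    rw [div_le_iff₀ (by linarith)]
    have : 0 ≤ Real.log (N : ℝ) := Real.log_natCast_nonneg _
    nlinarith
  exact mul_le_mul_of_nonneg_right hdiv hlogm

/-- Imprimitive versus primitive smoothed prime-power sums against the window weight, for the primitive data of a
non-trivial character: `‖K_{g,Λ^𝔪_ψ}(0) − K_{g,Λ_{χ₀}}(0)‖ ≤ 2(hi + 2) log N𝔪`. [cite: ThornerZaman2017, Lemma 9.3] -/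
theorem norm_coefFordK_windowTest_sub_le {𝔪 : Ideal (𝓞 K)} {ψ : HeightOneSpectrum (𝓞 K) → ℂ}
    (D : RayClassPrimitiveData 𝔪 ψ) {lo hi ε : ℝ} (hhi : 0 ≤ hi) (hε : 0 < ε) (hε1 : ε ≤ 1) :
    ‖coefFordK (rcCoef 𝔪 ψ) (windowTest lo hi ε) 0 - coefFordK (rcCoef D.𝔣 D.χ₀) (windowTest lo hi ε) 0‖ ≤
      2 * (hi + 2) * Real.log (Ideal.absNorm 𝔪 : ℕ) := by
  refine norm_coefFordK_sub_le_of_windowTest D.modulus_ne_bot (fun n ↦ ?_) hhi hε hε1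
  rw [norm_sub_rev]; exact D.norm_rcCoef_sub_rcCoef_le n

/-- The trivial character: smoothed sums `mod 𝔪` versus all ideals against the window weight:
`‖K_{g,Λ^𝔪_1}(0) − K_{g,Λ_K}(0)‖ ≤ 2(hi + 2) log N𝔪`. [cite: ThornerZaman2017, Lemma 9.3] -/
theorem norm_coefFordK_windowTest_one_sub_le {𝔪 : Ideal (𝓞 K)} (h𝔪 : 𝔪 ≠ ⊥) {lo hi ε : ℝ} (hhi : 0 ≤ hi)
    (hε : 0 < ε) (hε1 : ε ≤ 1) :
    ‖coefFordK (rcCoef 𝔪 (fun _ ↦ (1 : ℂ))) (windowTest lo hi ε) 0 -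
        coefFordK (cgCoef (1 : ClassGroup (𝓞 K) →* ℂˣ)) (windowTest lo hi ε) 0‖ ≤
      2 * (hi + 2) * Real.log (Ideal.absNorm 𝔪 : ℕ) := by
  refine norm_coefFordK_sub_le_of_windowTest h𝔪 (fun n ↦ ?_) hhi hε hε1
  rw [norm_sub_rev]; exact norm_cgCoef_one_sub_rcCoef_le 𝔪 n

/-! ### The explicit formula of `F_ψ` against the window weight, read two-sidedly, exceptional zeros kept -/

variable {G : Type} [CommGroup G] [Finite G] {𝔪 : Ideal (𝓞 K)} {f : HeightOneSpectrum (𝓞 K) → G}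
variable (h𝔪 : 𝔪 ≠ ⊥) (hray : ArtinKillsRay 𝔪 f)
  (hsep : ∀ χ : AddChar (Additive G) ℂ, χ ≠ 0 →
    ∃ v : HeightOneSpectrum (𝓞 K), ¬ 𝔪 ≤ v.asIdeal ∧ χ (Additive.ofMul (f v)) ≠ 1)

set_option maxHeartbeats 800000 in
/-- **The explicit formula of `F_ψ` against the window weight, read two-sidedly through the imprimitive coefficients,
exceptional zeros kept.**  For `ψ ∈ Ĝ`, `0 < ε < lo < hi`, `ε ≤ 1`, `g = windowTest lo hi ε`, a finite set `Exc` of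
non-trivial zeros of `F_ψ`, a bound `B` for the finite partial sums of `m_ψ‖F(−ρ)‖` over the non-trivial zeros outside
`Exc`, and bounds `M₀`, `J` for the trivial-zero term `m_ψ(0)(hi − lo + 2ε)` and the left-line integral:
`‖K_{g,Λ^𝔪_ψ}(0) − [ψ = 0]F(−1) + Σ_{ρ ∈ Exc} m_ψ(ρ)F(−ρ)‖ ≤ B + M₀ + J + 2(hi + 2) log N𝔪`.
[cite: ThornerZaman2017, Lemma 9.3, §8] [cite: LagariasMontgomeryOdlyzko1979, §7] -/
theorem norm_coefFordK_rayFamF_window_sub_le (ψ : AddChar (Additive G) ℂ) {lo hi ε : ℝ}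
    (hε : 0 < ε) (hε1 : ε ≤ 1) (hεlo : ε < lo) (hlohi : lo < hi)
    (Exc : Finset ℂ) (hExc : ∀ ρ ∈ Exc, rayFamF h𝔪 hray hsep ψ ρ = 0 ∧ 0 < ρ.re ∧ ρ.re < 1)
    {B M₀ J : ℝ}
    (hB : ∀ u : Finset ℂ, (∀ ρ ∈ u, rayFamF h𝔪 hray hsep ψ ρ = 0 ∧ 0 < ρ.re ∧ ρ.re < 1) →
      ∑ ρ ∈ u with ρ ∉ Exc, (analyticOrderNatAt (rayFamF h𝔪 hray hsep ψ) ρ : ℝ) *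
        ‖fordLaplace (windowTest lo hi ε) (-ρ)‖ ≤ B)
    (hM₀ : (analyticOrderNatAt (rayFamF h𝔪 hray hsep ψ) 0 : ℝ) * (hi - lo + 2 * ε) ≤ M₀)
    (hJ0 : ψ = 0 → ‖dzEFRemainder K (windowTest lo hi ε) 0‖ ≤ J)
    (hJ : ∀ hψ : ψ ≠ 0, ‖rcEFRemainder (datumData h𝔪 hray hsep ψ hψ).L (windowTest lo hi ε) 0‖ ≤ J) :
    ‖coefFordK (rcCoef 𝔪 (charFun f ψ)) (windowTest lo hi ε) 0 -
        (if ψ = 0 then fordLaplace (windowTest lo hi ε) (-1) else 0) +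
        ∑ ρ ∈ Exc, (analyticOrderNatAt (rayFamF h𝔪 hray hsep ψ) ρ : ℂ) * fordLaplace (windowTest lo hi ε) (-ρ)‖ ≤
      B + M₀ + J + 2 * (hi + 2) * Real.log (Ideal.absNorm 𝔪 : ℕ) := by
  set g := windowTest lo hi ε with hg
  have hhi : 0 ≤ hi := by linarith
  have hadm : IsSmoothedEFTest g g (deriv g) (deriv (deriv g)) (hi + ε) :=
    isSmoothedEFTest_windowTest hε hεlo.le hlohi.le
  have hg0 : g 0 = 0 := windowTest_zero hε hεlo.le
  have hF0 : ‖fordLaplace₀ g 0‖ ≤ hi - lo + 2 * ε := by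
    rw [fordLaplace₀_eq_fordLaplace hg0]; exact norm_fordLaplace_windowTest_zero_le hε hεlo.le hlohi.le
  by_cases hψ : ψ = 0
  · -- `ψ = 0`: `F_0 = ζ₁_K`, coefficients `Λ^𝔪_1` versus `Λ_K`
    subst hψ
    simp only [if_true]
    have hsz : ∀ ρ : ℂ, dedekindZeta₁ K ρ = 0 → 0 < ρ.re → ρ.re < 1 → ρ ≠ 0 := by
      intro ρ _ h1 _ h; rw [h] at h1; simp at h1
    have hexpl := coefFordK_one_eq_explicit (K := K) hadm hg0 (s := 0) (by norm_num) (by norm_num) hsz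
    have hsum := summable_norm_dzZeroTerm (K := K) hadm (s := 0) (by norm_num) hsz
    have hExc' : ∀ ρ ∈ Exc, dedekindZeta₁ K ρ = 0 ∧ 0 < ρ.re ∧ ρ.re < 1 := by
      intro ρ hρ; have := hExc ρ hρ; rwa [rayFamF_zero] at this
    have hB' : ∀ u : Finset ℂ, (∀ ρ ∈ u, dedekindZeta₁ K ρ = 0 ∧ 0 < ρ.re ∧ ρ.re < 1) →
        ∑ ρ ∈ u with ρ ∉ Exc, (analyticOrderNatAt (dedekindZeta₁ K) ρ : ℝ) *
          ‖fordLaplace g (-ρ)‖ ≤ B := by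
      intro u hu
      have := hB u (fun ρ hρ ↦ by rw [rayFamF_zero]; exact hu ρ hρ)
      simpa only [rayFamF_zero] using this
    have hmain : fordLaplace₀ g (0 - 1) = fordLaplace g (-1) := by
      rw [zero_sub, fordLaplace₀_eq_fordLaplace hg0]
    rw [hmain] at hexpl
    have key := norm_explicit_core hg0 hsum hexpl hF0 Exc hExc' hB'
    have hm : (analyticOrderNatAt (rayFamF h𝔪 hray hsep 0) 0 : ℝ) = (analyticOrderNatAt (dedekindZeta₁ K) 0 : ℝ) := by
      rw [rayFamF_zero]
    rw [hm] at hM₀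
    have hJ' := hJ0 rfl
    have hsumE : ∑ ρ ∈ Exc, (analyticOrderNatAt (rayFamF h𝔪 hray hsep 0) ρ : ℂ) * fordLaplace g (-ρ) =
        ∑ ρ ∈ Exc, (analyticOrderNatAt (dedekindZeta₁ K) ρ : ℂ) * fordLaplace g (-ρ) := by
      refine Finset.sum_congr rfl fun ρ _ ↦ ?_
      rw [rayFamF_zero]
    rw [hsumE, charFun_zero]
    -- the imprimitive correction
    have hcorr := norm_coefFordK_windowTest_one_sub_le (K := K) h𝔪 (lo := lo) hhi hε hε1
    have htri : ‖coefFordK (rcCoef 𝔪 (fun _ ↦ (1 : ℂ))) g 0 - fordLaplace g (-1) +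
        ∑ ρ ∈ Exc, (analyticOrderNatAt (dedekindZeta₁ K) ρ : ℂ) * fordLaplace g (-ρ)‖ ≤
        ‖coefFordK (cgCoef (1 : ClassGroup (𝓞 K) →* ℂˣ)) g 0 - fordLaplace g (-1) +
          ∑ ρ ∈ Exc, (analyticOrderNatAt (dedekindZeta₁ K) ρ : ℂ) * fordLaplace g (-ρ)‖ +
        ‖coefFordK (rcCoef 𝔪 (fun _ ↦ (1 : ℂ))) g 0 -
          coefFordK (cgCoef (1 : ClassGroup (𝓞 K) →* ℂˣ)) g 0‖ := by
      have e : coefFordK (rcCoef 𝔪 (fun _ ↦ (1 : ℂ))) g 0 - fordLaplace g (-1) +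
          ∑ ρ ∈ Exc, (analyticOrderNatAt (dedekindZeta₁ K) ρ : ℂ) * fordLaplace g (-ρ) =
          (coefFordK (cgCoef (1 : ClassGroup (𝓞 K) →* ℂˣ)) g 0 - fordLaplace g (-1) +
            ∑ ρ ∈ Exc, (analyticOrderNatAt (dedekindZeta₁ K) ρ : ℂ) * fordLaplace g (-ρ)) +
          (coefFordK (rcCoef 𝔪 (fun _ ↦ (1 : ℂ))) g 0 -
            coefFordK (cgCoef (1 : ClassGroup (𝓞 K) →* ℂˣ)) g 0) := by ring
      rw [e]; exact norm_add_le _ _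
    refine htri.trans ?_
    have := mul_le_mul_of_nonneg_left hF0 (Nat.cast_nonneg (analyticOrderNatAt (dedekindZeta₁ K) 0))
    linarith
  · -- `ψ ≠ 0`: `F_ψ = L_ψ`, coefficients `Λ^𝔪_ψ` versus `Λ_{χ₀}`
    simp only [hψ, if_false, sub_zero]
    set D := datumData h𝔪 hray hsep ψ hψ with hD
    have hnt := charFun_nontrivial hsep hψ
    have hFψ : rayFamF h𝔪 hray hsep ψ = D.L := rayFamF_of_ne h𝔪 hray hsep hψ
    have hsz : ∀ ρ : ℂ, D.L ρ = 0 → 0 < ρ.re → ρ.re < 1 → ρ ≠ 0 := by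
      intro ρ _ h1 _ h; rw [h] at h1; simp at h1
    have hexpl := rcCoefFordK_eq_explicit D.isRayClassCharacter D.isPrimitive D.isSignType D.ne_bot
      (D.nontrivial hnt) D.differentiable D.L_eq D.differentiable_Lconj (fun s hs ↦ D.Lconj_eq hs) hadm hg0
      (s := 0) (by norm_num) (by norm_num) hsz
    have hsum := summable_norm_rcZeroTerm D.isRayClassCharacter D.isPrimitive D.isSignType D.ne_bot
      (D.nontrivial hnt) D.differentiable D.L_eq D.differentiable_Lconj (fun s hs ↦ D.Lconj_eq hs) hadm
      (s := 0) (by norm_num) hsz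
    have hExc' : ∀ ρ ∈ Exc, D.L ρ = 0 ∧ 0 < ρ.re ∧ ρ.re < 1 := by
      intro ρ hρ; have := hExc ρ hρ; rwa [hFψ] at this
    have hB' : ∀ u : Finset ℂ, (∀ ρ ∈ u, D.L ρ = 0 ∧ 0 < ρ.re ∧ ρ.re < 1) →
        ∑ ρ ∈ u with ρ ∉ Exc, (analyticOrderNatAt D.L ρ : ℝ) * ‖fordLaplace g (-ρ)‖ ≤ B := by
      intro u hu
      have := hB u (fun ρ hρ ↦ by rw [hFψ]; exact hu ρ hρ)
      simpa only [hFψ] using this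
    have hexpl' : coefFordK (rcCoef D.𝔣 D.χ₀) g 0 = 0 -
        (∑' ρ : nontrivialZeros D.L,
          (analyticOrderNatAt D.L (ρ : ℂ) : ℂ) * fordLaplace₀ g (0 - ρ)) -
        (analyticOrderNatAt D.L 0 : ℂ) * fordLaplace₀ g 0 + rcEFRemainder D.L g 0 := by
      rw [hexpl]; ring
    have key := norm_explicit_core hg0 hsum hexpl' hF0 Exc hExc' hB'
    have hm : (analyticOrderNatAt (rayFamF h𝔪 hray hsep ψ) 0 : ℝ) = (analyticOrderNatAt D.L 0 : ℝ) := by rw [hFψ]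
    rw [hm] at hM₀
    have hJ' := hJ hψ
    have hsumE : ∑ ρ ∈ Exc, (analyticOrderNatAt (rayFamF h𝔪 hray hsep ψ) ρ : ℂ) * fordLaplace g (-ρ) =
        ∑ ρ ∈ Exc, (analyticOrderNatAt D.L ρ : ℂ) * fordLaplace g (-ρ) := by
      refine Finset.sum_congr rfl fun ρ _ ↦ ?_
      rw [hFψ]
    rw [hsumE]
    rw [sub_zero] at key
    -- the imprimitive correction
    have hcorr := norm_coefFordK_windowTest_sub_le D (lo := lo) hhi hε hε1
    have htri : ‖coefFordK (rcCoef 𝔪 (charFun f ψ)) g 0 +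
        ∑ ρ ∈ Exc, (analyticOrderNatAt D.L ρ : ℂ) * fordLaplace g (-ρ)‖ ≤
        ‖coefFordK (rcCoef D.𝔣 D.χ₀) g 0 +
          ∑ ρ ∈ Exc, (analyticOrderNatAt D.L ρ : ℂ) * fordLaplace g (-ρ)‖ +
        ‖coefFordK (rcCoef 𝔪 (charFun f ψ)) g 0 - coefFordK (rcCoef D.𝔣 D.χ₀) g 0‖ := by
      have e : coefFordK (rcCoef 𝔪 (charFun f ψ)) g 0 +
          ∑ ρ ∈ Exc, (analyticOrderNatAt D.L ρ : ℂ) * fordLaplace g (-ρ) =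
          (coefFordK (rcCoef D.𝔣 D.χ₀) g 0 +
            ∑ ρ ∈ Exc, (analyticOrderNatAt D.L ρ : ℂ) * fordLaplace g (-ρ)) +
          (coefFordK (rcCoef 𝔪 (charFun f ψ)) g 0 - coefFordK (rcCoef D.𝔣 D.χ₀) g 0) := by
        ring
      rw [e]; exact norm_add_le _ _
    refine htri.trans ?_
    have := mul_le_mul_of_nonneg_left hF0 (Nat.cast_nonneg (analyticOrderNatAt D.L 0))
    linarith

/-! ### The assembly over the family -/

set_option maxHeartbeats 1600000 in
/-- **The smoothed coset sum against the window weight through the family, two-sided, exceptional zeros kept.**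
For `0 < ε < lo < hi`, `ε ≤ 1`, `g = windowTest lo hi ε`, a coset `τ ∈ G`, finite sets `Exc ψ` of non-trivial zeros
of `F_ψ` containing all those in the exceptional segment `rayExcRegion c K 𝔪`, a FAMILY bound `Bf` for the finite
partial sums of the zero terms off the segment (`family_zeroSum_window_le_zfr`), and bounds `M₀`, `J` for the
trivial-zero terms and the left-line integrals of every member:
`‖|G| ψ̃_τ(g) − F(−1) + Σ_ψ ψ(τ)⁻¹ Σ_{ρ ∈ Exc ψ} m_ψ(ρ)F(−ρ)‖ ≤ Bf + |G|(M₀ + J + 2(hi + 2) log N𝔪)`.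
[cite: ThornerZaman2017, §8 (8.2)–(8.3)] [cite: LagariasMontgomeryOdlyzko1979, §7] -/
theorem norm_card_mul_smoothedPsiFiber_window_sub_le {lo hi ε c : ℝ} (hε : 0 < ε) (hε1 : ε ≤ 1)
    (hεlo : ε < lo) (hlohi : lo < hi) (τ : G)
    (Exc : AddChar (Additive G) ℂ → Finset ℂ)
    (hExc : ∀ ψ, ∀ ρ ∈ Exc ψ, rayFamF h𝔪 hray hsep ψ ρ = 0 ∧ 0 < ρ.re ∧ ρ.re < 1)
    (hExc' : ∀ ψ ρ, rayFamF h𝔪 hray hsep ψ ρ = 0 → 0 < ρ.re → ρ.re < 1 → rayExcRegion c K 𝔪 ρ → ρ ∈ Exc ψ)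
    {Bf M₀ J : ℝ}
    (hBf : ∀ u : AddChar (Additive G) ℂ → Finset ℂ,
        (∀ ψ, ∀ ρ ∈ u ψ, rayFamF h𝔪 hray hsep ψ ρ = 0 ∧ 0 < ρ.re ∧ ρ.re < 1) →
        ∑ ψ, ∑ ρ ∈ u ψ with ¬ rayExcRegion c K 𝔪 ρ,
            (analyticOrderNatAt (rayFamF h𝔪 hray hsep ψ) ρ : ℝ) * ‖fordLaplace (windowTest lo hi ε) (-ρ)‖ ≤ Bf)
    (hM₀ : ∀ ψ, (analyticOrderNatAt (rayFamF h𝔪 hray hsep ψ) 0 : ℝ) * (hi - lo + 2 * ε) ≤ M₀)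
    (hJ0 : ‖dzEFRemainder K (windowTest lo hi ε) 0‖ ≤ J)
    (hJ : ∀ (ψ : AddChar (Additive G) ℂ) (hψ : ψ ≠ 0),
      ‖rcEFRemainder (datumData h𝔪 hray hsep ψ hψ).L (windowTest lo hi ε) 0‖ ≤ J) :
    ‖(Nat.card G : ℂ) * (smoothedPsiFiber 𝔪 f τ (windowTest lo hi ε) : ℂ) -
        fordLaplace (windowTest lo hi ε) (-1) +
        ∑ ψ : AddChar (Additive G) ℂ, (ψ (Additive.ofMul τ))⁻¹ *
          ∑ ρ ∈ Exc ψ, (analyticOrderNatAt (rayFamF h𝔪 hray hsep ψ) ρ : ℂ) *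
            fordLaplace (windowTest lo hi ε) (-ρ)‖ ≤
      Bf + (Nat.card G : ℝ) * (M₀ + J + 2 * (hi + 2) * Real.log (Ideal.absNorm 𝔪 : ℕ)) := by
  set g := windowTest lo hi ε with hg
  have hg0' : ∀ u, hi + ε ≤ u → g u = 0 := fun u hu ↦ windowTest_eq_zero_of_ge hε hu
  set Ecorr : ℝ := 2 * (hi + 2) * Real.log (Ideal.absNorm 𝔪 : ℕ) with hEcorr
  -- the per-character suprema
  set P : AddChar (Additive G) ℂ → Finset ℂ → ℝ := fun ψ u ↦
    ∑ ρ ∈ u with ((rayFamF h𝔪 hray hsep ψ ρ = 0 ∧ 0 < ρ.re ∧ ρ.re < 1) ∧ ρ ∉ Exc ψ),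
      (analyticOrderNatAt (rayFamF h𝔪 hray hsep ψ) ρ : ℝ) * ‖fordLaplace g (-ρ)‖ with hP
  have hP0 : ∀ ψ u, 0 ≤ P ψ u := fun ψ u ↦
    Finset.sum_nonneg fun ρ _ ↦ mul_nonneg (Nat.cast_nonneg _) (norm_nonneg _)
  have hPB : ∀ u : AddChar (Additive G) ℂ → Finset ℂ, ∑ ψ, P ψ (u ψ) ≤ Bf := by
    intro u
    have h := hBf (fun ψ ↦ (u ψ).filter (fun ρ ↦ rayFamF h𝔪 hray hsep ψ ρ = 0 ∧ 0 < ρ.re ∧ ρ.re < 1))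
      (fun ψ ρ hρ ↦ (Finset.mem_filter.1 hρ).2)
    refine le_trans (Finset.sum_le_sum fun ψ _ ↦ ?_) h
    rw [hP]; dsimp only
    rw [Finset.filter_filter]
    refine Finset.sum_le_sum_of_subset_of_nonneg (fun ρ hρ ↦ ?_)
      fun ρ _ _ ↦ mul_nonneg (Nat.cast_nonneg _) (norm_nonneg _)
    rw [Finset.mem_filter] at hρ ⊢
    refine ⟨hρ.1, hρ.2.1, fun hexc ↦ hρ.2.2 (hExc' ψ ρ hρ.2.1.1 hρ.2.1.2.1 hρ.2.1.2.2 hexc)⟩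
  have hsup := sum_ciSup_le_of_forall_sum_le P hP0 hPB
  have hbdd : ∀ ψ, BddAbove (Set.range (P ψ)) := by
    intro ψ
    refine ⟨Bf, ?_⟩
    rintro _ ⟨u, rfl⟩
    have h := hPB (Function.update (fun _ ↦ (∅ : Finset ℂ)) ψ u)
    have hle : P ψ u ≤ ∑ φ, P φ (Function.update (fun _ ↦ (∅ : Finset ℂ)) ψ u φ) := by
      rw [← Finset.sum_erase_add _ _ (Finset.mem_univ ψ)]
      simp only [Function.update_self]
      have : 0 ≤ ∑ φ ∈ Finset.univ.erase ψ, P φ (Function.update (fun _ ↦ (∅ : Finset ℂ)) ψ u φ) :=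
        Finset.sum_nonneg fun φ _ ↦ hP0 _ _
      linarith
    exact hle.trans h
  -- the per-character estimate with `B_ψ = ⨆_u P ψ u`
  have hper : ∀ ψ : AddChar (Additive G) ℂ,
      ‖coefFordK (rcCoef 𝔪 (charFun f ψ)) g 0 - (if ψ = 0 then fordLaplace g (-1) else 0) +
          ∑ ρ ∈ Exc ψ, (analyticOrderNatAt (rayFamF h𝔪 hray hsep ψ) ρ : ℂ) * fordLaplace g (-ρ)‖ ≤
        (⨆ u, P ψ u) + M₀ + J + Ecorr := by
    intro ψ
    refine norm_coefFordK_rayFamF_window_sub_le h𝔪 hray hsep ψ hε hε1 hεlo hlohi (Exc ψ) (hExc ψ)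
      (fun u hu ↦ ?_) (hM₀ ψ) (fun _ ↦ hJ0) (fun h0 ↦ hJ ψ h0)
    refine le_trans (le_of_eq ?_) (le_ciSup (hbdd ψ) u)
    rw [hP]; dsimp only
    refine Finset.sum_congr (Finset.filter_congr fun ρ hρ ↦ ?_) fun _ _ ↦ rfl
    exact ⟨fun h ↦ ⟨hu ρ hρ, h⟩, fun h ↦ h.2⟩
  -- orthogonality
  have horth := card_mul_smoothedPsiFiber (𝔪 := 𝔪) (f := f) τ hg0'
  have hmain : ∑ ψ : AddChar (Additive G) ℂ,
      (ψ (Additive.ofMul τ))⁻¹ * (if ψ = 0 then fordLaplace g (-1) else 0) = fordLaplace g (-1) := by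
    rw [Finset.sum_eq_single (0 : AddChar (Additive G) ℂ)]
    · rw [if_pos rfl, AddChar.zero_apply, inv_one, one_mul]
    · intro ψ _ hψ; rw [if_neg hψ, mul_zero]
    · intro h; exact absurd (Finset.mem_univ _) h
  have hid : (Nat.card G : ℂ) * (smoothedPsiFiber 𝔪 f τ g : ℂ) - fordLaplace g (-1) +
      ∑ ψ : AddChar (Additive G) ℂ, (ψ (Additive.ofMul τ))⁻¹ *
        ∑ ρ ∈ Exc ψ, (analyticOrderNatAt (rayFamF h𝔪 hray hsep ψ) ρ : ℂ) * fordLaplace g (-ρ) =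
      ∑ ψ : AddChar (Additive G) ℂ, (ψ (Additive.ofMul τ))⁻¹ *
        (coefFordK (rcCoef 𝔪 (charFun f ψ)) g 0 - (if ψ = 0 then fordLaplace g (-1) else 0) +
          ∑ ρ ∈ Exc ψ, (analyticOrderNatAt (rayFamF h𝔪 hray hsep ψ) ρ : ℂ) * fordLaplace g (-ρ)) := by
    rw [horth]
    simp only [mul_add, mul_sub, Finset.sum_add_distrib, Finset.sum_sub_distrib, hmain]
  rw [hid]
  have hcard : (Finset.univ : Finset (AddChar (Additive G) ℂ)).card = Nat.card G := by
    rw [Finset.card_univ, card_addChar_eq_natCard]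
  calc ‖∑ ψ : AddChar (Additive G) ℂ, (ψ (Additive.ofMul τ))⁻¹ *
        (coefFordK (rcCoef 𝔪 (charFun f ψ)) g 0 - (if ψ = 0 then fordLaplace g (-1) else 0) +
          ∑ ρ ∈ Exc ψ, (analyticOrderNatAt (rayFamF h𝔪 hray hsep ψ) ρ : ℂ) * fordLaplace g (-ρ))‖
      ≤ ∑ ψ : AddChar (Additive G) ℂ, ‖(ψ (Additive.ofMul τ))⁻¹ *
        (coefFordK (rcCoef 𝔪 (charFun f ψ)) g 0 - (if ψ = 0 then fordLaplace g (-1) else 0) +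
          ∑ ρ ∈ Exc ψ, (analyticOrderNatAt (rayFamF h𝔪 hray hsep ψ) ρ : ℂ) * fordLaplace g (-ρ))‖ :=
        norm_sum_le _ _
    _ ≤ ∑ ψ : AddChar (Additive G) ℂ, ((⨆ u, P ψ u) + M₀ + J + Ecorr) := by
        refine Finset.sum_le_sum fun ψ _ ↦ ?_
        rw [norm_mul, norm_inv, AddChar.norm_apply, inv_one, one_mul]
        exact hper ψ
    _ = ∑ ψ : AddChar (Additive G) ℂ, (⨆ u, P ψ u) + (Nat.card G : ℝ) * (M₀ + J + Ecorr) := by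
        rw [Finset.sum_add_distrib, Finset.sum_add_distrib, Finset.sum_add_distrib, Finset.sum_const,
          Finset.sum_const, Finset.sum_const, nsmul_eq_mul, nsmul_eq_mul, nsmul_eq_mul, hcard]
        ring
    _ ≤ Bf + (Nat.card G : ℝ) * (M₀ + J + Ecorr) := add_le_add hsup le_rfl

end Summit.QuantumAdvantage.QuantumAdvantage.Theorems.DegreeOnePrimesEscape

end
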